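import Literature.MathematicalPhysics.QuantumFieldTheory.Balaban1983to89.B7BlockAvgLog
import Literature.MathematicalPhysics.QuantumFieldTheory.Balaban1983to89.B7Eq61Linearization

/-!
# `Balaban1983to89.B7Eq78Linearization` — the averaging operations `R̄₀uʲ` for gauge transformations (B7 (78)–(80))
and their linear parts `Q′_j(U₀)` (B8 p. 80; B9 (3.19), p. 394): the derivative at `u = 1`, kernel-checked

CITATION HEADER (lean-in-tree rule 2026-08-18).  The papers quoted are UNDER ADJUDICATION by the audit cell
`pub-balaban` (near-miss programme `Balaban 4-d lattice YM UV stability series`); nothing printed in them is asserted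
here as a fact.  Every quotation below was re-read for this module from the x4 page renders (PNG read as an image, not
an OCR layer): B7 = T. Bałaban, *Averaging operations for lattice gauge theories*, Comm. Math. Phys. **98**, 17–51 (1985)
[Balaban1985Averaging] (journal page = PDF page + 16), render
`b2b-balaban-ref1/pages/1985-cmp98-averaging/1985-cmp98-averaging-p014-x4.png` (p. 30); B8 = T. Bałaban, *Spaces of
regular gauge field configurations on a lattice and gauge fixing conditions*, Comm. Math. Phys. **99**, 75–102 (1985)
[Balaban1985RegularSpaces] (journal page = PDF page + 74), render `…/1985-cmp99-regular-spaces-gauge-fixing/…-p006-x4.png`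
(p. 80); B9 = T. Bałaban, *Propagators for lattice gauge theories in a background field*, Comm. Math. Phys. **99**, 389–434
(1985) [Balaban1985BackgroundPropagators] (journal page = PDF page + 388), renders
`…/1985-cmp99-background-propagators/…-p005-x4.png`, `…-p006-x4.png` (pp. 393–394).  References inside the quotations:
B8's [3] = B7; B9's [5] = B7.  Cell records: GAPS C-B8-40 (this certificate; it closes residue (1) of C-B8-39),
DIVERGENCE D-b08-g16.1; unit `b2b-balaban-b08-g16`.  No existing module is modified; this module imports
`…B7BlockAvgLog` (for the tree's carrier `barAvg` of the bar of (42)/(78)/(82), `barAvg_eq_exp_sum`, and through it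
`MatrixLog.mlog` = the series (21)) and `…B7Eq61Linearization` (for the one-step linear operator `Qp0` = `Q′₀` of B7
p. 28 / `Q′(V)` of B9 (3.19) on `ℤᵈ` blocks, to which §5 bridges) and touches nothing else.

WHAT IS PRINTED (verbatim; `‾` = the paper's overbar, `R̄₀` = `R₀` under a bar).
* B7 p. 27 [PDF 11] (56): *"where for arbitrary invertible matrix X the operator R(X) is given by the formula
  R(X)Y = XYX⁻¹. (56)"*
* B7 p. 30 [PDF 14]: *"At first we define inductively a kth order averaging operation for gauge transformations.
  Generally a one-step averaging transformation defined by a field configuration V₀ is given by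
  (R̄₀v)(y) = (R(V₀)v‾)(y) = {(R(V₀)v)(x)}‾_{x∈B(y)} = v(y) exp[i Σ_{x∈B(y)} L⁻ᵈ (1/i) log v⁻¹(y)R(V₀(Γ_{y,x}))v(x)], (78)
  where v is defined on a lattice Ω′, y ∈ Ω′⁽¹⁾. For a given configuration U₀ we define inductively
  (R̄₀u)(x₁) = (R(U₀)u‾)(x₁), x₁ ∈ Ω⁽¹⁾, (79) (R̄₀u^{j+1})(x_{j+1}) = (R(Ū₀ʲ)R̄₀uʲ‾)(x_{j+1}), x_{j+1} ∈ Ω⁽ʲ⁺¹⁾. (80)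
  The additional conditions are (R̄₀uᵏ)(y) = 1, y ∈ Ω⁽ᵏ⁾. (81)"*
* B8 p. 80 [PDF 6]: *"The allowed gauge transformations u are restricted by the conditions (1.14): u(y) = 1, y ∈ 𝔅_k.
  These conditions are very hard to work with analytically and we have to replace them by conditions imposed on some
  averages of u rather than on values of u at the points of 𝔅_k. We choose the averages which were described in detail
  in [3], formulas (78)–(80), and denoted by R̄₀uʲ. Let us notice that for u(x) = e^{iλ(x)} and λ small a linear part of
  the function (1/i) log(R̄₀uʲ)(y) is equal to (Q′_j(U₀)λ)(y), and the definition of the Landau gauge depends on these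
  averaging operations."*
* B9 p. 393 [PDF 5] (3.19): *"(Q′(V)λ)(y) = Σ_{x∈B(y)} L⁻ᵈR(V(Γ_{y,x}))λ(x),
  (Q′_j(U)λ)(y) = (Q′(Ūʲ⁻¹)·…·Q′(Ū)Q′(U)λ)(y) = Σ_{x∈Bʲ(y)} L⁻ʲᵈR(U(Γ⁽ʲ⁾_{y,x}))λ(x), y ∈ T⁽ʲ⁾_{Lʲη}. (3.19)
  The contours Γ⁽ʲ⁾_{y,x}, x ∈ Bʲ(y), and the contour variables U(Γ⁽ʲ⁾_{y,x}) were defined by (52), (53) in [5]."*;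
  p. 393 bottom / p. 394 top [PDF 5–6]: *"The above averaging operators Q′_j(U) are linear parts of the averaging
  operations Ruʲ‾ for gauge transformations u = e^{iλ}, operations defined by (78)–(80) in [5]."*
Neither B7, B8 nor B9 proves the "linear part" sentence; it is stated (twice) and used — in B8 to define the Landau
gauge (1.27)–(1.29) through `N(Q′(U₀))`, in B9 for the gauge-fixing density (3.17)–(3.21).  This module proves it.

THE TYPED OBJECTS.  Values: a complete normed `ℂ`-algebra `𝔸` (matrices `M_N(ℂ)`, or any C⋆-algebra; the group `G`
sits inside as units, the Lie algebra as elements `a = iλ`); `exp` = Mathlib's `NormedSpace.exp`, `log` = the series (21)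
`MatrixLog.mlog`; `R(X)Y = XYX⁻¹` = `conjR X Y` for a unit `X : 𝔸ˣ` ((56)).  Geometry, all free: ONE ambient site type `ι`
carrying every lattice `Ω⁽ʲ⁾` (in print the lattices are nested point sets, `Ω′⁽¹⁾ ⊂ Ω′`), and a `Blocking ι` = for each
level `j` and coarse site `y` the block `B j y : Finset ι` (printed `B(y) ⊂ Ω⁽ʲ⁾`, `Lᵈ` sites), the point `base j y : ι` at
which the fine function is evaluated in the prefactor `v(y)` of (78) (printed: `y` itself, the lattices being nested; in
the scaled integer coordinates of `QuantumLattice.BalabanRG`, where every level is `ℤᵈ` again, it is the corner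
`blockBase L y = L·y`, §5), and real weights `wt j y x` (printed `L⁻ᵈ`; `Blocking.Normalised` = `Σ_{x∈B(y)} wt = 1`, which is
what `Lᵈ` sites of weight `L⁻ᵈ` give, `zdBlocking_normalised`).  Transporter data, free: `T j y x : 𝔸ˣ` (printed
`Ū₀ʲ(Γ_{y,x})`, the parallel transporter of the `j`-th averaged background along the contour `Γ_{y,x}` of B7 (52)–(53);
the theorems hold for EVERY `T`, so neither the contours nor the averaged configurations `Ū₀ʲ` of (74)–(77) are modelled).
Then, on the tree's carrier `B7BlockAvgLog.barAvg t wt W = exp[i Σ_{x∈t} wt_x (1/i) log W_x]`: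
`avgStep t wt T vy v = vy · {v_y⁻¹ R(T_x) v_x}‾ = v(y) exp[i Σ_{x∈B(y)} L⁻ᵈ (1/i) log v⁻¹(y)R(V₀(Γ_{y,x}))v(x)]` = (78)
(`vy` = the prefactor value `v(y)`, `v⁻¹(y)` = `Ring.inverse vy`, the inverse on units); `Rbar G T j u` = `R̄₀uʲ` by the
recursion (79)–(80) (`Rbar G T 0 u = u`, `Rbar G T (j+1) u y = avgStep (B j y) (wt j y) (T j y) ((R̄₀uʲ)(base j y)) (R̄₀uʲ)`);
`Qprime t wt T μ = Σ_{x∈t} wt_x R(T_x)μ(x)` = `(Q′(V)μ)(y)` of (3.19) and `QprimeIter G T j` = `Q′_j = Q′(Ū^{j−1})⋯Q′(U)`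
(first form of (3.19); `QprimeIter G T 0 = id`).

WHAT IS PROVED (0 sorry; [folklore] = calculus/algebra the papers use without comment).
§1 Calculus bookkeeping in a Banach algebra: `hasFDerivAt_logOnePlus_zero` / `hasFDerivAt_mlog_one` (the derivative of
   the series (21) at `1` is the identity — first coefficient of the power series), the chain rules along a curve
   through `1` resp. `0` for `log`, `exp`, `X ↦ X⁻¹` (`hasDerivAt_mlog_comp`, `hasDerivAt_exp_comp_zero`,
   `hasDerivAt_inverse_comp_one`) and for `R(T)` (`hasDerivAt_conjR_comp`).
§2 (78) one step: `avgStep_eq_mul_exp_sum` (the factors `i`, `1/i` cancel), `avgStep_one` (`R̄₀1 = 1`), and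
   **`hasDerivAt_avgStep`**: along any curves `γ`, `v_x` through `1` with velocities `γ′`, `v′_x`,
   `d/ds|₀ [γ(s)·{γ(s)⁻¹R(T_x)v_x(s)}‾] = γ′ + Σ_x wt_x (R(T_x)v′_x − γ′)`, which for normalised weights is
   `Σ_x wt_x R(T_x)v′_x = Qprime t wt T v′` (`hasDerivAt_avgStep_of_sum_eq_one`) — the prefactor `v(y)` and the `v⁻¹(y)`
   under the logarithm cancel to first order exactly when `Σ_{x∈B(y)} L⁻ᵈ = 1`.
§3 (3.19): `Qprime`, `QprimeIter`, their `ℂ`-homogeneity (`Qprime_smul`, `QprimeIter_smul`) and additivity.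
§4 (79)–(80) and THE SENTENCE: `Rbar_one` (`R̄₀1ʲ = 1`, so (81) holds at `u = 1`); **`hasDerivAt_Rbar`**: for a normalised
   blocking, every transporter family `T`, every direction field `a : ι → 𝔸`, every `j` and `y`,
   `HasDerivAt (s ↦ (R̄₀(e^{sa})ʲ)(y)) ((Q′_j a)(y)) 0`; **`hasDerivAt_mlog_Rbar`**: the same for `s ↦ log(R̄₀(e^{sa})ʲ)(y)`;
   **`hasDerivAt_invI_smul_mlog_Rbar`** = B8 p. 80 / B9 p. 394 literally: with `u = e^{isλ}`,
   `d/ds|₀ (1/i) log(R̄₀uʲ)(y) = (Q′_j(U₀)λ)(y)`, over `s ∈ ℂ` and (`hasDerivAt_invI_smul_mlog_Rbar_real`) over `s ∈ ℝ`;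
   `deriv_invI_smul_mlog_Rbar` (the `deriv` form).  "Linear part" is certified as this first derivative at `λ = 0` in
   every direction `λ` (the Gateaux differential); nothing is asserted about higher-order terms.
§5 The `ℤᵈ` instance in scaled coordinates (`zdBlocking d L`: blocks `QuantumLattice.blockSites L y`, base point
   `blockBase L y`, weights `L⁻ᵈ`): `zdBlocking_normalised` (`#B(y) = Lᵈ`), **`Qprime_zd_eq_Qp0`** /
   `QprimeIter_zd_succ`: the one-step operator IS `B7Eq61Linearization.Qp0 L (R ∘ T_j)` (gen-15's `Q′₀`, B9's `Q′(Ūʲ)`),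
   so `Q′_j` = the composite of (3.19); `hasDerivAt_invI_smul_mlog_Rbar_zd` = the sentence on `ℤᵈ` blocks for every
   `L ≥ 1`, every level-transporter family and every `λ`.

HONEST SCOPE / DIVERGENCE (recorded as D-b08-g16.1, not silent).  (i) Carrier: one ambient site type with free finite
blocks (print: finite lattices `Ω⁽ʲ⁾ ⊂ T_{Lʲη}`; every statement is a finite sum per block, so it is the printed one on
each block); in §5 all of `ℤᵈ` per level in scaled coordinates, as in `B7Eq61Linearization` (D-b08-g15.1 (i)).
(ii) Contours not modelled: `T` free (printed `Ū₀ʲ(Γ_{y,x})` is one instance) — more general, and the reason the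
collapsed second form of (3.19) (`Σ_{x∈Bʲ(y)} L⁻ʲᵈ R(U(Γ⁽ʲ⁾_{y,x}))`, which needs the composite contours (52)–(53)) is NOT
typed here (its flat case is `B7Eq61Linearization.Qp_Qp`).  (iii) `v⁻¹(y)` is `Ring.inverse` (the inverse on units, `0`
off units — never met along the curves used, which pass through `1`).  (iv) Gauge transformations are typed `𝔸`-valued and
the parameter `s` complex: the printed `u = e^{iλ}` with `λ` real-Lie-algebra-valued is the case `a = iλ`, `s ∈ ℝ`
(`…_real`); unitarity is not needed for a first-derivative statement and not assumed.  (v) "Linear part" = first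
derivative at `u = 1` along `s ↦ e^{isλ}` for each fixed `λ` (directional); the Fréchet packaging over the Banach space
of all `λ` (finite lattices) is not typed.  (vi) Weights: the theorem needs exactly `Σ_{x∈B(y)} wt = 1` (printed `L⁻ᵈ`
over `Lᵈ` sites); for un-normalised weights the linear part is `γ′ + Σ wt (R v′ − γ′)` (`hasDerivAt_avgStep`), not `Q′`.
VALUE = kernel certificate of a printed-but-unproved sentence (B8 p. 80 = B9 p. 394) on the printed objects (78)–(80),
(3.19); closes residue (1) of GAPS C-B8-39; NOT summit progress.
-/

noncomputable section

namespace Literature.MathematicalPhysics.QuantumFieldTheory.Balaban1983to89.B7Eq78Linearization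

open NormedSpace Finset
open Literature.Analysis.Complex (logOnePlus logSeriesCoeff hasFPowerSeriesOnBall_logOnePlus)
open Literature.MathematicalPhysics.QuantumFieldTheory.Balaban1983to89.MatrixLog (mlog mlog_one)
open Literature.MathematicalPhysics.QuantumFieldTheory.Balaban1983to89.B7BlockAvgLog (barAvg barAvg_eq_exp_sum)
open Literature.MathematicalPhysics.QuantumLattice (blockSites blockBase card_blockSites)

variable {𝔸 : Type*} [NormedRing 𝔸] [NormedAlgebra ℂ 𝔸] [CompleteSpace 𝔸]

/-! ## §1 Calculus bookkeeping: derivatives of `log`, `exp`, `X ↦ X⁻¹`, `R(T)` along curves -/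

section Calculus

/-- [folklore] The derivative of the logarithmic series `x ↦ log(1 + x)` at `0` is the identity (the coefficient of
`x¹` in (21) is `1`). -/
theorem hasFDerivAt_logOnePlus_zero :
    HasFDerivAt (logOnePlus : 𝔸 → 𝔸) (ContinuousLinearMap.id ℂ 𝔸) 0 := by
  refine (hasFPowerSeriesOnBall_logOnePlus (𝔄 := 𝔸)).hasFPowerSeriesAt.hasFDerivAt.congr_fderiv ?_
  ext x
  have hs : (Fin.snoc (0 : Fin 0 → 𝔸) x : Fin 1 → 𝔸) = fun _ => x := by
    funext i
    fin_cases i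
    rfl
  rw [continuousMultilinearCurryFin1_apply, hs, FormalMultilinearSeries.ofScalars_apply_eq]
  norm_num [logSeriesCoeff]

/-- [folklore] The derivative of `log` ((21), `MatrixLog.mlog X = logOnePlus (X − 1)`) at `X = 1` is the identity. -/
theorem hasFDerivAt_mlog_one :
    HasFDerivAt (mlog : 𝔸 → 𝔸) (ContinuousLinearMap.id ℂ 𝔸) 1 := by
  have h1 : HasFDerivAt (fun Y : 𝔸 => Y - 1) (ContinuousLinearMap.id ℂ 𝔸) 1 :=
    (hasFDerivAt_id (1 : 𝔸)).sub_const 1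
  have e : (fun Y : 𝔸 => Y - 1) 1 = 0 := sub_self _
  have h2 : HasFDerivAt (logOnePlus : 𝔸 → 𝔸) (ContinuousLinearMap.id ℂ 𝔸) ((fun Y : 𝔸 => Y - 1) 1) := by
    rw [e]
    exact hasFDerivAt_logOnePlus_zero
  have h3 := HasFDerivAt.comp (1 : 𝔸) (g := (logOnePlus : 𝔸 → 𝔸)) (f := fun Y : 𝔸 => Y - 1) h2 h1
  rw [ContinuousLinearMap.id_comp] at h3
  exact h3

/-- [folklore] Chain rule for `log` along a curve through `1`: if `γ(s₀) = 1` and `γ′(s₀) = γ'` then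
`(log ∘ γ)′(s₀) = γ'`. -/
theorem hasDerivAt_mlog_comp {γ : ℂ → 𝔸} {γ' : 𝔸} {s₀ : ℂ} (h0 : γ s₀ = 1) (hγ : HasDerivAt γ γ' s₀) :
    HasDerivAt (fun s => mlog (γ s)) γ' s₀ := by
  have h := hasFDerivAt_mlog_one (𝔸 := 𝔸)
  rw [← h0] at h
  simpa [Function.comp_def] using h.comp_hasDerivAt s₀ hγ

/-- [folklore] Chain rule for `exp` along a curve through `0`: if `S(s₀) = 0` and `S′(s₀) = S'` then
`(exp ∘ S)′(s₀) = S'`. -/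
theorem hasDerivAt_exp_comp_zero {S : ℂ → 𝔸} {S' : 𝔸} {s₀ : ℂ} (h0 : S s₀ = 0) (hS : HasDerivAt S S' s₀) :
    HasDerivAt (fun s => exp (S s)) S' s₀ := by
  have h := hasFDerivAt_exp_zero (𝕂 := ℂ) (𝔸 := 𝔸)
  rw [← h0] at h
  simpa [Function.comp_def] using h.comp_hasDerivAt s₀ hS

/-- [folklore] Chain rule for the inverse along a curve through `1`: if `γ(s₀) = 1` and `γ′(s₀) = γ'` then
`(γ⁻¹)′(s₀) = −γ'` (`Ring.inverse`, differentiated at the unit `1`). -/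
theorem hasDerivAt_inverse_comp_one {γ : ℂ → 𝔸} {γ' : 𝔸} {s₀ : ℂ} (h0 : γ s₀ = 1) (hγ : HasDerivAt γ γ' s₀) :
    HasDerivAt (fun s => Ring.inverse (γ s)) (-γ') s₀ := by
  have h := hasFDerivAt_ringInverse (𝕜 := ℂ) (1 : 𝔸ˣ)
  rw [Units.val_one, ← h0] at h
  simpa [Function.comp_def] using h.comp_hasDerivAt s₀ hγ

/-- [cite: Balaban1985Averaging, (56) p.27] `R(X)Y = XYX⁻¹` for an invertible `X` (a unit of `𝔸`). -/
def conjR (X : 𝔸ˣ) (Y : 𝔸) : 𝔸 := (X : 𝔸) * Y * ((X⁻¹ : 𝔸ˣ) : 𝔸)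

omit [NormedAlgebra ℂ 𝔸] [CompleteSpace 𝔸] in
/-- [folklore] unfolding of `conjR`. -/
theorem conjR_apply (X : 𝔸ˣ) (Y : 𝔸) : conjR X Y = (X : 𝔸) * Y * ((X⁻¹ : 𝔸ˣ) : 𝔸) := rfl

omit [NormedAlgebra ℂ 𝔸] [CompleteSpace 𝔸] in
/-- [folklore] `R(X)1 = 1`. -/
@[simp] theorem conjR_one (X : 𝔸ˣ) : conjR X (1 : 𝔸) = 1 := by
  simp [conjR]

omit [NormedAlgebra ℂ 𝔸] [CompleteSpace 𝔸] in
/-- [folklore] `R(X)` is additive. -/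
theorem conjR_add (X : 𝔸ˣ) (Y Z : 𝔸) : conjR X (Y + Z) = conjR X Y + conjR X Z := by
  simp [conjR, mul_add, add_mul]

omit [NormedAlgebra ℂ 𝔸] [CompleteSpace 𝔸] in
/-- [folklore] `R(X)` is subtractive. -/
theorem conjR_sub (X : 𝔸ˣ) (Y Z : 𝔸) : conjR X (Y - Z) = conjR X Y - conjR X Z := by
  simp [conjR, mul_sub, sub_mul]

omit [CompleteSpace 𝔸] in
/-- [folklore] `R(X)` commutes with complex scalars. -/
theorem conjR_smul (X : 𝔸ˣ) (c : ℂ) (Y : 𝔸) : conjR X (c • Y) = c • conjR X Y := by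
  simp [conjR]

omit [CompleteSpace 𝔸] in
/-- [folklore] `R(X)` commutes with real scalars. -/
theorem conjR_smul_real (X : 𝔸ˣ) (c : ℝ) (Y : 𝔸) : conjR X (c • Y) = c • conjR X Y := by
  simp [conjR]

omit [CompleteSpace 𝔸] in
/-- [folklore] `R(T)` is linear, hence differentiates through: `(R(T)f)′ = R(T)f′`. -/
theorem hasDerivAt_conjR_comp (X : 𝔸ˣ) {f : ℂ → 𝔸} {f' : 𝔸} {s₀ : ℂ} (hf : HasDerivAt f f' s₀) :
    HasDerivAt (fun s => conjR X (f s)) (conjR X f') s₀ := by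
  unfold conjR
  exact (hf.const_mul (X : 𝔸)).mul_const _

/-- [folklore] the one-parameter group `s ↦ e^{sa}` has velocity `a` at `s = 0`. -/
theorem hasDerivAt_exp_smul_zero (a : 𝔸) : HasDerivAt (fun s : ℂ => exp (s • a)) a 0 := by
  simpa using hasDerivAt_exp_smul_const' (𝕂 := ℂ) a 0

end Calculus

/-! ## §2 The one-step averaging transformation (78) and its linear part -/

section OneStep

variable {ι : Type*}

/-- [cite: Balaban1985Averaging, (78) p.30] **(78)**, one step: `(R̄₀v)(y) = v(y) exp[i Σ_{x∈B(y)} L⁻ᵈ (1/i) log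
v⁻¹(y)R(V₀(Γ_{y,x}))v(x)]` — block `t = B(y)`, weights `wt` (printed `L⁻ᵈ`), transporters `T x` (printed `V₀(Γ_{y,x})`),
prefactor value `vy = v(y)`, site values `v x`; the bar is the tree's `B7BlockAvgLog.barAvg` (base value `v(y)` stripped
on the left, as recorded there), `v⁻¹(y)` is `Ring.inverse vy`. -/
def avgStep (t : Finset ι) (wt : ι → ℝ) (T : ι → 𝔸ˣ) (vy : 𝔸) (v : ι → 𝔸) : 𝔸 :=
  vy * barAvg t wt (fun x => Ring.inverse vy * conjR (T x) (v x))

omit [CompleteSpace 𝔸] in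
/-- [cite: Balaban1985Averaging, (78) p.30] (78) with the factors `i`, `1/i` cancelled:
`(R̄₀v)(y) = v(y) exp[Σ_{x∈B(y)} wt_x log(v⁻¹(y)R(T_x)v(x))]`. -/
theorem avgStep_eq_mul_exp_sum (t : Finset ι) (wt : ι → ℝ) (T : ι → 𝔸ˣ) (vy : 𝔸) (v : ι → 𝔸) :
    avgStep t wt T vy v = vy * exp (∑ x ∈ t, wt x • mlog (Ring.inverse vy * conjR (T x) (v x))) := by
  rw [avgStep, barAvg_eq_exp_sum]

omit [CompleteSpace 𝔸] in
/-- [folklore] `R̄₀1 = 1`: the average of the identity gauge transformation is the identity ((81) holds at `u = 1`). -/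
theorem avgStep_one (t : Finset ι) (wt : ι → ℝ) (T : ι → 𝔸ˣ) :
    avgStep t wt T (1 : 𝔸) (fun _ => (1 : 𝔸)) = 1 := by
  rw [avgStep_eq_mul_exp_sum]
  simp [mlog_one]

omit [NormedRing 𝔸] [NormedAlgebra ℂ 𝔸] [CompleteSpace 𝔸] in
/-- [folklore] `Σ_x wt_x (c_x − g) = Σ_x wt_x c_x − (Σ_x wt_x) g`. -/
theorem sum_smul_sub_const {V : Type*} [AddCommGroup V] [Module ℝ V] (t : Finset ι) (wt : ι → ℝ) (c : ι → V) (g : V) :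
    ∑ x ∈ t, wt x • (c x - g) = ∑ x ∈ t, wt x • c x - (∑ x ∈ t, wt x) • g := by
  simp only [smul_sub, Finset.sum_sub_distrib, Finset.sum_smul]

/-- [cite: Balaban1985BackgroundPropagators, (3.19) p.393] **(3.19), one step:** `(Q′(V)μ)(y) = Σ_{x∈B(y)} L⁻ᵈ R(V(Γ_{y,x}))μ(x)`
— block `t = B(y)`, weights `wt` (printed `L⁻ᵈ`), transporters `T x` (printed `V(Γ_{y,x})`). On `ℤᵈ` blocks this is
`B7Eq61Linearization.Qp0` (`Qprime_zd_eq_Qp0`). -/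
def Qprime (t : Finset ι) (wt : ι → ℝ) (T : ι → 𝔸ˣ) (μ : ι → 𝔸) : 𝔸 :=
  ∑ x ∈ t, wt x • conjR (T x) (μ x)

omit [CompleteSpace 𝔸] in
/-- [folklore] unfolding of `Qprime`. -/
theorem Qprime_apply (t : Finset ι) (wt : ι → ℝ) (T : ι → 𝔸ˣ) (μ : ι → 𝔸) :
    Qprime t wt T μ = ∑ x ∈ t, wt x • conjR (T x) (μ x) := rfl

omit [CompleteSpace 𝔸] in
/-- [folklore] `Q′` is `ℂ`-homogeneous. -/
theorem Qprime_smul (t : Finset ι) (wt : ι → ℝ) (T : ι → 𝔸ˣ) (c : ℂ) (μ : ι → 𝔸) :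
    Qprime t wt T (fun x => c • μ x) = c • Qprime t wt T μ := by
  simp only [Qprime_apply, conjR_smul, Finset.smul_sum]
  exact Finset.sum_congr rfl fun x _ => smul_comm _ _ _

omit [CompleteSpace 𝔸] in
/-- [folklore] `Q′` is additive. -/
theorem Qprime_add (t : Finset ι) (wt : ι → ℝ) (T : ι → 𝔸ˣ) (μ ν : ι → 𝔸) :
    Qprime t wt T (fun x => μ x + ν x) = Qprime t wt T μ + Qprime t wt T ν := by
  simp only [Qprime_apply, conjR_add, smul_add, Finset.sum_add_distrib]

omit [CompleteSpace 𝔸] in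
/-- [folklore] `Q′` depends on `μ` only through its values on the block. -/
theorem Qprime_congr (t : Finset ι) (wt : ι → ℝ) (T : ι → 𝔸ˣ) {μ ν : ι → 𝔸} (h : ∀ x ∈ t, μ x = ν x) :
    Qprime t wt T μ = Qprime t wt T ν :=
  Finset.sum_congr rfl fun x hx => by rw [h x hx]

/-- [folklore] **The linear part of one averaging step (78), general weights.** Along curves `γ` (the prefactor
`v(y)`) and `v_x` (the site values) through `1` at `s₀` with velocities `γ'`, `v'_x`:
`d/ds|_{s₀} [γ(s) exp(Σ_x wt_x log(γ(s)⁻¹ R(T_x) v_x(s)))] = γ' + Σ_x wt_x (R(T_x)v'_x − γ')`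
(product rule; `d log|₁ = id`, `d exp|₀ = id`, `d(X⁻¹)|₁ = −id`). -/
theorem hasDerivAt_avgStep (t : Finset ι) (wt : ι → ℝ) (T : ι → 𝔸ˣ) {γ : ℂ → 𝔸} {v : ι → ℂ → 𝔸} {γ' : 𝔸}
    {v' : ι → 𝔸} {s₀ : ℂ} (hγ0 : γ s₀ = 1) (hv0 : ∀ x ∈ t, v x s₀ = 1) (hγ : HasDerivAt γ γ' s₀)
    (hv : ∀ x ∈ t, HasDerivAt (v x) (v' x) s₀) :
    HasDerivAt (fun s => avgStep t wt T (γ s) (fun x => v x s))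
      (γ' + ∑ x ∈ t, wt x • (conjR (T x) (v' x) - γ')) s₀ := by
  -- the arguments of the logarithms
  have hin : ∀ x ∈ t, HasDerivAt (fun s => Ring.inverse (γ s) * conjR (T x) (v x s))
      (conjR (T x) (v' x) - γ') s₀ := by
    intro x hx
    have h := (hasDerivAt_inverse_comp_one hγ0 hγ).mul (hasDerivAt_conjR_comp (T x) (hv x hx))
    refine h.congr_deriv ?_
    simp only [hγ0, hv0 x hx, Ring.inverse_one, conjR_one, mul_one, one_mul]
    abel
  have hin0 : ∀ x ∈ t, Ring.inverse (γ s₀) * conjR (T x) (v x s₀) = 1 := by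
    intro x hx
    simp [hγ0, hv0 x hx]
  -- their logarithms
  have hlog : ∀ x ∈ t, HasDerivAt (fun s => wt x • mlog (Ring.inverse (γ s) * conjR (T x) (v x s)))
      (wt x • (conjR (T x) (v' x) - γ')) s₀ := fun x hx =>
    (hasDerivAt_mlog_comp (hin0 x hx) (hin x hx)).fun_const_smul (wt x)
  -- the exponent
  have hS : HasDerivAt (fun s => ∑ x ∈ t, wt x • mlog (Ring.inverse (γ s) * conjR (T x) (v x s)))
      (∑ x ∈ t, wt x • (conjR (T x) (v' x) - γ')) s₀ := HasDerivAt.fun_sum hlog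
  have hS0 : ∑ x ∈ t, wt x • mlog (Ring.inverse (γ s₀) * conjR (T x) (v x s₀)) = 0 :=
    Finset.sum_eq_zero fun x hx => by rw [hin0 x hx, mlog_one, smul_zero]
  -- the exponential and the product
  have hE := hasDerivAt_exp_comp_zero hS0 hS
  have hP := hγ.mul hE
  have e : (fun s => avgStep t wt T (γ s) (fun x => v x s)) =
      (γ * fun s => exp (∑ x ∈ t, wt x • mlog (Ring.inverse (γ s) * conjR (T x) (v x s)))) := by
    funext s
    rw [avgStep_eq_mul_exp_sum]
    rfl
  rw [e]
  refine hP.congr_deriv ?_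
  rw [hS0, exp_zero, mul_one, hγ0, one_mul]

/-- [folklore] **The linear part of (78) for normalised weights** (`Σ_{x∈B(y)} wt = 1`, the printed `L⁻ᵈ` over `Lᵈ`
sites): the prefactor `v(y)` and the `v⁻¹(y)` under the logarithm cancel to first order and
`d/ds|_{s₀} (R̄₀v_s)(y) = Σ_x wt_x R(T_x)v'_x = (Q′(V₀)v')(y)`. -/
theorem hasDerivAt_avgStep_of_sum_eq_one (t : Finset ι) (wt : ι → ℝ) (T : ι → 𝔸ˣ) (hwt : ∑ x ∈ t, wt x = 1)
    {γ : ℂ → 𝔸} {v : ι → ℂ → 𝔸} {γ' : 𝔸} {v' : ι → 𝔸} {s₀ : ℂ} (hγ0 : γ s₀ = 1) (hv0 : ∀ x ∈ t, v x s₀ = 1)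
    (hγ : HasDerivAt γ γ' s₀) (hv : ∀ x ∈ t, HasDerivAt (v x) (v' x) s₀) :
    HasDerivAt (fun s => avgStep t wt T (γ s) (fun x => v x s)) (Qprime t wt T v') s₀ := by
  refine (hasDerivAt_avgStep t wt T hγ0 hv0 hγ hv).congr_deriv ?_
  rw [sum_smul_sub_const, hwt, one_smul, Qprime_apply]
  abel

end OneStep

/-! ## §3–§4 The `k`-th order averaging operation (79)–(80), the operators `Q′_j` (3.19), and the sentence -/

section Tower

variable {ι : Type*}

/-- [cite: Balaban1985Averaging, (78)–(80) p.30] The block geometry of the sequence of averagings: for each level `j`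
and coarse site `y ∈ Ω⁽ʲ⁺¹⁾` the block `B j y ⊂ Ω⁽ʲ⁾` (printed `B(y)`), the point `base j y` at which `(R̄₀uʲ)` is
evaluated in the prefactor of (78) (printed: `y` itself — nested lattices; `blockBase L y` in scaled coordinates, §5), and
the weights `wt j y x` (printed `L⁻ᵈ`). One ambient site type `ι` carries all levels. -/
structure Blocking (ι : Type*) where
  /-- the block `B(y) ⊂ Ω⁽ʲ⁾` of the level-`(j+1)` site `y` -/
  B : ℕ → ι → Finset ι
  /-- the level-`j` point at which the prefactor `v(y)` of (78) is read -/
  base : ℕ → ι → ι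
  /-- the averaging weights (printed `L⁻ᵈ`) -/
  wt : ℕ → ι → ι → ℝ

/-- [cite: Balaban1985Averaging, (78) p.30] normalised weights: `Σ_{x∈B(y)} wt = 1` (printed: `Lᵈ` sites of weight
`L⁻ᵈ`). -/
def Blocking.Normalised (G : Blocking ι) : Prop := ∀ j y, ∑ x ∈ G.B j y, G.wt j y x = 1

/-- [cite: Balaban1985Averaging, (79)–(80) p.30] **`R̄₀uʲ`, the `j`-th order averaging operation for gauge
transformations:** `R̄₀u⁰ = u`, (79) `(R̄₀u)(x₁) = (R(U₀)u‾)(x₁)`, (80) `(R̄₀u^{j+1})(x_{j+1}) = (R(Ū₀ʲ)R̄₀uʲ‾)(x_{j+1})`,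
each step being (78) with `V₀ = Ū₀ʲ`, i.e. with the level-`j` transporters `T j y x` (printed `Ū₀ʲ(Γ_{y,x})`). -/
def Rbar (G : Blocking ι) (T : ℕ → ι → ι → 𝔸ˣ) : ℕ → (ι → 𝔸) → ι → 𝔸
  | 0, u => u
  | j + 1, u => fun y => avgStep (G.B j y) (G.wt j y) (T j y) (Rbar G T j u (G.base j y)) (Rbar G T j u)

/-- [cite: Balaban1985BackgroundPropagators, (3.19) p.393] **`Q′_j(U) = Q′(Ūʲ⁻¹)·…·Q′(Ū)Q′(U)`** (first form of (3.19);
`Q′₀ = id`), the one-step factors being `Qprime` with the level transporters `T j y` (printed `R(Ūʲ(Γ_{y,x}))`). -/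
def QprimeIter (G : Blocking ι) (T : ℕ → ι → ι → 𝔸ˣ) : ℕ → (ι → 𝔸) → ι → 𝔸
  | 0, μ => μ
  | j + 1, μ => fun y => Qprime (G.B j y) (G.wt j y) (T j y) (QprimeIter G T j μ)

variable (G : Blocking ι) (T : ℕ → ι → ι → 𝔸ˣ)

omit [CompleteSpace 𝔸] in
/-- [folklore] unfolding of `Rbar` at level `0`. -/
@[simp] theorem Rbar_zero (u : ι → 𝔸) : Rbar G T 0 u = u := rfl

omit [CompleteSpace 𝔸] in
/-- [cite: Balaban1985Averaging, (80) p.30] unfolding of (80). -/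
theorem Rbar_succ (j : ℕ) (u : ι → 𝔸) (y : ι) :
    Rbar G T (j + 1) u y = avgStep (G.B j y) (G.wt j y) (T j y) (Rbar G T j u (G.base j y)) (Rbar G T j u) := rfl

omit [CompleteSpace 𝔸] in
/-- [folklore] unfolding of `QprimeIter` at level `0`. -/
@[simp] theorem QprimeIter_zero (μ : ι → 𝔸) : QprimeIter G T 0 μ = μ := rfl

omit [CompleteSpace 𝔸] in
/-- [cite: Balaban1985BackgroundPropagators, (3.19) p.393] unfolding of the composition (3.19). -/
theorem QprimeIter_succ (j : ℕ) (μ : ι → 𝔸) (y : ι) :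
    QprimeIter G T (j + 1) μ y = Qprime (G.B j y) (G.wt j y) (T j y) (QprimeIter G T j μ) := rfl

omit [CompleteSpace 𝔸] in
/-- [folklore] `Q′_j` is `ℂ`-homogeneous. -/
theorem QprimeIter_smul (c : ℂ) (μ : ι → 𝔸) : ∀ j : ℕ, QprimeIter G T j (fun x => c • μ x) = fun y => c • QprimeIter G T j μ y
  | 0 => rfl
  | j + 1 => by
    funext y
    rw [QprimeIter_succ, QprimeIter_smul c μ j, Qprime_smul, QprimeIter_succ]

omit [CompleteSpace 𝔸] in
/-- [folklore] `Q′_j` is additive. -/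
theorem QprimeIter_add (μ ν : ι → 𝔸) :
    ∀ j : ℕ, QprimeIter G T j (fun x => μ x + ν x) = fun y => QprimeIter G T j μ y + QprimeIter G T j ν y
  | 0 => rfl
  | j + 1 => by
    funext y
    rw [QprimeIter_succ, QprimeIter_add μ ν j, Qprime_add, QprimeIter_succ, QprimeIter_succ]

omit [CompleteSpace 𝔸] in
/-- [folklore] **`R̄₀1ʲ = 1`**: every averaging of the identity transformation is the identity (so the conditions (81) /
B8 (1.29) hold at `u = 1`, the point at which the linear part is taken). -/
theorem Rbar_one : ∀ j : ℕ, Rbar G T j (fun _ => (1 : 𝔸)) = fun _ => 1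
  | 0 => rfl
  | j + 1 => by
    funext y
    rw [Rbar_succ, Rbar_one j, avgStep_one]

omit [CompleteSpace 𝔸] in
/-- [folklore] at `s = 0` the family `u_s = e^{sa}` is the identity transformation, and so are all its averages. -/
theorem Rbar_exp_zero_smul (a : ι → 𝔸) (j : ℕ) (y : ι) :
    Rbar G T j (fun x => exp ((0 : ℂ) • a x)) y = 1 := by
  have e : (fun x => exp ((0 : ℂ) • a x)) = fun _ : ι => (1 : 𝔸) := by
    funext x
    rw [zero_smul, exp_zero]
  rw [e, Rbar_one]

/-- [cite: Balaban1985RegularSpaces, p.80] **THE LINEAR PART OF `R̄₀uʲ` (B8 p. 80 / B9 p. 394), derivative form.** For a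
normalised blocking, every transporter family `T` (printed `Ū₀ʲ(Γ_{y,x})`), every direction field `a` (printed `iλ`),
every order `j` and site `y`: `s ↦ (R̄₀(e^{sa})ʲ)(y)` has derivative `(Q′_j a)(y)` at `s = 0`.  Induction on `j` by
`hasDerivAt_avgStep_of_sum_eq_one` — the step `j → j+1` is exactly "`Q′(Ū₀ʲ)` is the linear part of (80)". -/
theorem hasDerivAt_Rbar (hG : G.Normalised) (a : ι → 𝔸) :
    ∀ (j : ℕ) (y : ι), HasDerivAt (fun s : ℂ => Rbar G T j (fun x => exp (s • a x)) y) (QprimeIter G T j a y) 0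
  | 0, y => by simpa using hasDerivAt_exp_smul_zero (a y)
  | j + 1, y => by
    have h := hasDerivAt_avgStep_of_sum_eq_one (G.B j y) (G.wt j y) (T j y) (hG j y)
      (γ := fun s : ℂ => Rbar G T j (fun x => exp (s • a x)) (G.base j y))
      (v := fun x (s : ℂ) => Rbar G T j (fun x => exp (s • a x)) x) (s₀ := 0)
      (Rbar_exp_zero_smul G T a j _) (fun x _ => Rbar_exp_zero_smul G T a j x)
      (hasDerivAt_Rbar hG a j _) (fun x _ => hasDerivAt_Rbar hG a j x)
    simpa only [Rbar_succ, QprimeIter_succ] using h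

/-- [cite: Balaban1985RegularSpaces, p.80] **The same for `log(R̄₀uʲ)(y)`**: `s ↦ log(R̄₀(e^{sa})ʲ)(y)` has derivative
`(Q′_j a)(y)` at `s = 0` (`d log|₁ = id`, `R̄₀1ʲ = 1`). -/
theorem hasDerivAt_mlog_Rbar (hG : G.Normalised) (a : ι → 𝔸) (j : ℕ) (y : ι) :
    HasDerivAt (fun s : ℂ => mlog (Rbar G T j (fun x => exp (s • a x)) y)) (QprimeIter G T j a y) 0 :=
  hasDerivAt_mlog_comp (Rbar_exp_zero_smul G T a j y) (hasDerivAt_Rbar G T hG a j y)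

/-- [cite: Balaban1985RegularSpaces, p.80] **B8 p. 80, literally** (*"for u(x) = e^{iλ(x)} and λ small a linear part
of the function (1/i) log(R̄₀uʲ)(y) is equal to (Q′_j(U₀)λ)(y)"*) = B9 p. 394 (*"operators Q′_j(U) are linear parts of
the averaging operations Ruʲ‾ for gauge transformations u = e^{iλ}"*): with `u_s = e^{isλ}`,
`d/ds|₀ (1/i) log(R̄₀u_sʲ)(y) = (Q′_j(U₀)λ)(y)` — for every normalised blocking, every transporter family, every `λ`,
`j`, `y`. -/
theorem hasDerivAt_invI_smul_mlog_Rbar (hG : G.Normalised) (lam : ι → 𝔸) (j : ℕ) (y : ι) :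
    HasDerivAt (fun s : ℂ => (Complex.I⁻¹ : ℂ) • mlog (Rbar G T j (fun x => exp (s • (Complex.I • lam x))) y))
      (QprimeIter G T j lam y) 0 := by
  have h := (hasDerivAt_mlog_Rbar G T hG (fun x => Complex.I • lam x) j y).fun_const_smul (Complex.I⁻¹ : ℂ)
  refine h.congr_deriv ?_
  rw [QprimeIter_smul, smul_smul, inv_mul_cancel₀ Complex.I_ne_zero, one_smul]

/-- [cite: Balaban1985RegularSpaces, p.80] the `deriv` form of the sentence: `deriv (s ↦ (1/i) log(R̄₀(e^{isλ})ʲ)(y)) 0 =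
(Q′_jλ)(y)`. -/
theorem deriv_invI_smul_mlog_Rbar (hG : G.Normalised) (lam : ι → 𝔸) (j : ℕ) (y : ι) :
    deriv (fun s : ℂ => (Complex.I⁻¹ : ℂ) • mlog (Rbar G T j (fun x => exp (s • (Complex.I • lam x))) y)) 0 =
      QprimeIter G T j lam y :=
  (hasDerivAt_invI_smul_mlog_Rbar G T hG lam j y).deriv

/-- [cite: Balaban1985RegularSpaces, p.80] the sentence over a REAL parameter (the printed `u = e^{iλ}` with `λ` in the
real Lie algebra, scaled `λ ↦ sλ`, `s ∈ ℝ`): `d/ds|₀ (1/i) log(R̄₀(e^{isλ})ʲ)(y) = (Q′_jλ)(y)`. -/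
theorem hasDerivAt_invI_smul_mlog_Rbar_real (hG : G.Normalised) (lam : ι → 𝔸) (j : ℕ) (y : ι) :
    HasDerivAt (fun s : ℝ => (Complex.I⁻¹ : ℂ) • mlog (Rbar G T j (fun x => exp ((s : ℂ) • (Complex.I • lam x))) y))
      (QprimeIter G T j lam y) 0 := by
  have hf' : HasDerivAt
      (fun s : ℂ => (Complex.I⁻¹ : ℂ) • mlog (Rbar G T j (fun x => exp (s • (Complex.I • lam x))) y))
      (QprimeIter G T j lam y) (Complex.ofRealCLM (0 : ℝ)) := by
    rw [Complex.ofRealCLM_apply, Complex.ofReal_zero]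
    exact hasDerivAt_invI_smul_mlog_Rbar G T hG lam j y
  have h := HasDerivAt.scomp (0 : ℝ) hf' (Complex.ofRealCLM.hasDerivAt (x := (0 : ℝ)))
  simpa [Function.comp_def] using h

end Tower

/-! ## §5 The `ℤᵈ` instance: blocks `blockSites L y`, weights `L⁻ᵈ`; bridge to `B7Eq61Linearization.Qp0` -/

section Zd

variable {d : ℕ}

/-- [cite: Balaban1985Averaging, (78)–(80) p.30] The printed block geometry in the scaled integer coordinates of
`QuantumLattice.BalabanRG` / `B7Eq61Linearization` (every level is `ℤᵈ`; the level-`(j+1)` site `y` has block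
`blockSites L y = {L·y + t : 0 ≤ t < L}` of `Lᵈ` level-`j` sites, corner `blockBase L y = L·y`, weight `L⁻ᵈ`). -/
def zdBlocking (d L : ℕ) : Blocking (Fin d → ℤ) where
  B := fun _ y => blockSites L y
  base := fun _ y => blockBase L y
  wt := fun _ _ _ => ((L : ℝ) ^ d)⁻¹

/-- [folklore] `Lᵈ` sites of weight `L⁻ᵈ`: the printed weights are normalised (`card_blockSites`). -/
theorem zdBlocking_normalised (L : ℕ) (hL : 0 < L) : (zdBlocking d L).Normalised := by
  intro j y
  have hLd : ((L : ℝ) ^ d) ≠ 0 := by positivity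
  simp only [zdBlocking, Finset.sum_const, card_blockSites, nsmul_eq_mul, Nat.cast_pow]
  exact mul_inv_cancel₀ hLd

omit [CompleteSpace 𝔸] in
/-- [cite: Balaban1985BackgroundPropagators, (3.19) p.393] **Bridge:** on `ℤᵈ` blocks the one-step operator of this module
IS gen-15's `B7Eq61Linearization.Qp0` (= `Q′₀` of B7 p. 28 = `Q′(V)` of (3.19)) with the conjugation action (56)
(`ConjAct 𝔸ˣ` on `𝔸`): `Σ_{x∈B(y)} L⁻ᵈ R(T_x)μ(x) = (Qp0 L (R∘T) μ)(y)`. -/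
theorem Qprime_zd_eq_Qp0 (L : ℕ) (Ty : (Fin d → ℤ) → 𝔸ˣ) (μ : (Fin d → ℤ) → 𝔸) (y : Fin d → ℤ) :
    Qprime (blockSites L y) (fun _ => ((L : ℝ) ^ d)⁻¹) Ty μ =
      B7Eq61Linearization.Qp0 L (fun x => ConjAct.toConjAct (Ty x)) μ y := by
  rw [Qprime_apply, B7Eq61Linearization.Qp0_apply]
  refine Finset.sum_congr rfl fun x _ => ?_
  rw [conjR_apply, ConjAct.units_smul_def, ConjAct.ofConjAct_toConjAct]

omit [CompleteSpace 𝔸] in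
/-- [cite: Balaban1985BackgroundPropagators, (3.19) p.393] hence `Q′_{j+1} = Q′(Ūʲ) ∘ Q′_j` with `Q′(Ūʲ) = Qp0 L (R∘T_j)`:
the composite (3.19) on `ℤᵈ` blocks, for level-transporter families `T j x` (the transporter from `x` to the corner of its
block, as in `B7Eq61Linearization`). -/
theorem QprimeIter_zd_succ (L : ℕ) (T : ℕ → (Fin d → ℤ) → 𝔸ˣ) (j : ℕ) (μ : (Fin d → ℤ) → 𝔸) (y : Fin d → ℤ) :
    QprimeIter (zdBlocking d L) (fun j _ x => T j x) (j + 1) μ y =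
      B7Eq61Linearization.Qp0 L (fun x => ConjAct.toConjAct (T j x))
        (QprimeIter (zdBlocking d L) (fun j _ x => T j x) j μ) y := by
  rw [QprimeIter_succ]
  exact Qprime_zd_eq_Qp0 L (T j) _ y

/-- [cite: Balaban1985RegularSpaces, p.80] **The sentence on `ℤᵈ` blocks:** for every `L ≥ 1`, every family of level
transporters `T j x` (printed `Ū₀ʲ(Γ_{y,x})`), every `λ`, `j`, `y`, with `u_s = e^{isλ}`:
`d/ds|₀ (1/i) log(R̄₀u_sʲ)(y) = (Q′_j(U₀)λ)(y)`, `Q′_j` the `j`-fold composite of `B7Eq61Linearization.Qp0`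
(`QprimeIter_zd_succ`). -/
theorem hasDerivAt_invI_smul_mlog_Rbar_zd (L : ℕ) (hL : 0 < L) (T : ℕ → (Fin d → ℤ) → 𝔸ˣ)
    (lam : (Fin d → ℤ) → 𝔸) (j : ℕ) (y : Fin d → ℤ) :
    HasDerivAt (fun s : ℂ => (Complex.I⁻¹ : ℂ) •
        mlog (Rbar (zdBlocking d L) (fun j _ x => T j x) j (fun x => exp (s • (Complex.I • lam x))) y))
      (QprimeIter (zdBlocking d L) (fun j _ x => T j x) j lam y) 0 :=
  hasDerivAt_invI_smul_mlog_Rbar _ _ (zdBlocking_normalised L hL) lam j y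

end Zd

end Literature.MathematicalPhysics.QuantumFieldTheory.Balaban1983to89.B7Eq78Linearization

end
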